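import Summits.BirchSwinnertonDyer.BirchSwinnertonDyer.Theorems.PrintX11aUpperNonSurjFiveExcDivisibilityCongr
import HarnessLib

/-!
# Crux U5 `PrintX11a.UpperNonSurjFive` (item stmt-BirchSwinnertonDyer-20614), line «gl1cartan5», EXCEPTIONAL-ZERO road:
# ★ the class-free / X11a / EXC-SHALLOW theorems WITHOUT Coleman–Edixhoven — `hCE` REPLACED by the curve-side condition
# «every multiplicative `ℓ ≠ p` at which `E[p]` is unramified has `ℓ ≢ 1 (mod p)`»

INPUTS desk `bsd-inputs` (D-0154 (2)), seat `bsd-inputs-honda-p1` (resident INPUTS prover), tranche T-G116 of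
`INPUTS-LIST-2-ADDENDUM-63 §A`; `--supports stmt-BirchSwinnertonDyer-20614`, closes nothing. Sequel of `…ExcDivisibilityCongr` (the CE-free
core and ★§1/★§2 with `hCE : colemanEdixhoven1998_heckePolynomial_simpleRoots` replaced by «`ℓ % p ≠ 1` on `D`»). Here the side condition is
moved to the CURVE: the primes of `D` are exactly the multiplicative `ℓ ≠ p` with `p ∣ ord_ℓ Δ_min` (`exists_unramifiedMultDecomposition`; on
class X11a: every multiplicative `ℓ ≠ p`), so «`ℓ % p ≠ 1` for those `ℓ`» replaces `hCE` in
`…ExcDivisibilityGeneral.one_le_padicValRat_LOne_div_of_split_of_finite` (p689696) and in the three X11a theorems of `…ExcShallowSector`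
(p686445). Effect for the INPUTS list: on that sub-locus the named print G116 (Coleman–Edixhoven 1998 Thm. 2.1) leaves the display of
the exceptional-zero road; on pairs with an unramified multiplicative `ℓ ≡ 1 (mod p)` (inhabited on U5: `ℓ = 41` at `118080ds1`, `p = 5`)
it stays load-bearing unless non-optimal level lowering (Diamond–Taylor 1994) is typed. Theorems only; no definition, no named fact, no
`sorry`; nothing here proves Coleman–Edixhoven; no summit statement is proved; BSD is not proved by any of this.

## References

* H. Darmon, F. Diamond, R. Taylor (1995), Thm. 3.15, Prop. 2.12 [DarmonDiamondTaylor1995]; R. Greenberg, V. Vatsal, Invent. Math. 142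
  (2000), §3 [GreenbergVatsal2000]; V. Vatsal, Duke Math. J. 98 (1999), §1 [Vatsal1999]; K. A. Ribet, ICM 1983, Thm. 4.1 [Ribet1984ICM];
  B. Mazur (1978), Cor. 4.1 [Mazur1978]; J.-P. Serre, Invent. Math. 15 (1972), §2.4 Prop. 15 [Serre1972]; J. H. Silverman, ATAEC (1994),
  Cor. IV.9.2 (d), Thm. IV.10.2 [SilvermanATAEC1994]; R. L. Miller, LMS J. Comput. Math. 14 (2011), Def. 1.1 [Miller2011LMS];
  R. F. Coleman, B. Edixhoven, Math. Ann. 310 (1998), Thm. 2.1 [ColemanEdixhoven1998].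
-/

set_option autoImplicit false
-- the Theorems namespace of a single-conjunct summit repeats the summit name by design (D-0017)
set_option linter.dupNamespace false

noncomputable section

open scoped MatrixGroups ModularForm Classical NNReal

open CongruenceSubgroup WeierstrassCurve Literature.NumberTheory.EllipticCurves
  Literature.NumberTheory.EllipticCurves.ModularForms
  Literature.NumberTheory.EllipticCurves.Rank1Residual
  Literature.NumberTheory.EllipticCurves.Rank1Residual.Typed
  Literature.NumberTheory.EllipticCurves.Wuthrich2014
  Summit.BirchSwinnertonDyer.Rank1Residual

namespace Summit.BirchSwinnertonDyer.BirchSwinnertonDyer.Theorems.GL1Cartan.Exc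

/-! ### §1 ★ Class-free and X11a forms: `hCE` replaced by the curve-side condition -/

section Curve

variable {W : WeierstrassCurve ℚ} [W.IsElliptic] [W.IsGloballyMinimal] {p : ℕ} [Fact p.Prime]

/-- ★ **THE EXCEPTIONAL-ZERO TAMAGAWA DIVISIBILITY, class-free and CE-free (CONDITIONAL on five named facts).** Let `E/ℚ` (globally minimal
`W`) have SPLIT multiplicative reduction at a prime `p ≥ 5`, with `E[p]` irreducible and FINITE at `p` (`p ∣ ord_p Δ_min`), and suppose that
EVERY multiplicative prime `ℓ ≠ p` at which `E[p]` is unramified (`p ∣ ord_ℓ Δ_min`) satisfies `ℓ ≢ 1 (mod p)`. If `L(E,1)/Ω_E = t ∈ ℚ` with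
`t ≠ 0`, then **`1 ≤ ord_p t`**. Facts BY NAME: `hGV`, `hI`, `hMz`, `hnf` (modularity), `hLL` (Darmon–Diamond–Taylor Thm. 3.15 at
`p ≥ 5`) — `…ExcDivisibilityGeneral.one_le_padicValRat_LOne_div_of_split_of_finite` with `hCE` REPLACED by the side condition (same road:
`exists_unramifiedMultDecomposition`, removed set `R = D·p`, the primes of `D` being exactly the unramified multiplicative `ℓ ≠ p`).
[cite: DarmonDiamondTaylor1995, Thm. 3.15 and Prop. 2.12 (d)] [cite: GreenbergVatsal2000, §3 (17)–(19), Remark 3.4]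
[cite: Vatsal1999, §1 (1.6), Thm. (1.13)] [cite: Ribet1984ICM, Thm. 4.1] [cite: Mazur1978, Cor. 4.1] -/
theorem one_le_padicValRat_LOne_div_of_split_of_finite_of_emod_ne_one
    (hGV : greenbergVatsal2000_plusSymbol_congruence) (hI : ribet1984_iharaLemma)
    (hMz : mazur_not_dvd_maninConstant_of_odd) (hnf : exists_isNewformOf) (hLL : ribet1990_levelLowering_gamma0_newform_general_of_five_le)
    (hp5 : 5 ≤ p) (hsplit : W.HasSplitMultiplicativeReductionAtPrime p) (hirr : W.HasIrreducibleModPGaloisRep p)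
    (hfin : p ∣ padicValInt p W.minimalDiscriminantInt)
    (hD1 : ∀ (ℓ : ℕ) (hℓ : ℓ.Prime), ℓ ≠ p → (haveI : Fact ℓ.Prime := ⟨hℓ⟩; W.HasMultiplicativeReductionAtPrime ℓ) →
      p ∣ padicValInt ℓ W.minimalDiscriminantInt → ℓ % p ≠ 1) :
    ∀ t : ℚ, W.entireLFunction 1 / (W.realPeriodRat : ℂ) = (t : ℂ) → t ≠ 0 → 1 ≤ padicValRat p t := by
  intro t ht ht0
  have hp : p.Prime := Fact.out
  haveI : NeZero (W.conductorNorm ℤ) := ⟨(W.conductorNorm_pos_holds).ne'⟩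
  obtain ⟨f, hf⟩ := hnf W
  have hmult : W.HasMultiplicativeReductionAtPrime p := hsplit.hasMultiplicativeReductionAtPrime
  obtain ⟨M₀, D, hM₀0, hMD, hpMD, hDsq, hDM₀, hDprimes, hmultD⟩ := exists_unramifiedMultDecomposition W p hmult
  haveI : NeZero M₀ := ⟨hM₀0⟩
  have hpD : ¬ p ∣ D := fun h => hpMD (h.mul_left M₀)
  have hpM₀ : ¬ p ∣ M₀ := fun h => hpMD (h.mul_right D)
  have hMR : M₀ * (D * p) = W.conductorNorm ℤ := by rw [← mul_assoc]; exact hMD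
  have hRsq : Squarefree (D * p) :=
    (Nat.squarefree_mul ((Nat.Prime.coprime_iff_not_dvd hp).mpr hpD).symm).mpr ⟨hDsq, hp.prime.squarefree⟩
  have hRcop : Nat.Coprime (D * p) M₀ := Nat.Coprime.mul_left hDM₀ ((Nat.Prime.coprime_iff_not_dvd hp).mpr hpM₀)
  have hp2N : ¬ p ^ 2 ∣ W.conductorNorm ℤ := Theorems.not_sq_dvd_conductorNorm_of_hasMultiplicativeReductionAtPrime W p hmult
  have hR : ∀ (r : ℕ) (hr : r.Prime), r ∣ D * p →
      (haveI : Fact r.Prime := ⟨hr⟩; W.HasMultiplicativeReductionAtPrime r) ∧ p ∣ padicValInt r W.minimalDiscriminantInt := by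
    intro r hr hrDp
    by_cases hrp : r = p
    · subst hrp
      exact ⟨hmult, hfin⟩
    · have hrD : r ∣ D := by
        rcases (Nat.Prime.dvd_mul hr).mp hrDp with h | h
        · exact h
        · exact absurd ((Nat.prime_dvd_prime_iff_eq hr hp).mp h) hrp
      obtain ⟨-, hmr, hur⟩ := hDprimes r hr hrD
      exact ⟨hmr, hur⟩
  have hK : ∀ (q : ℕ) (hq : q.Prime), (haveI : Fact q.Prime := ⟨hq⟩; W.HasMultiplicativeReductionAtPrime q) → ¬ q ∣ D * p →
      ¬ p ∣ padicValInt q W.minimalDiscriminantInt := by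
    intro q hq hqm hqR hqΔ
    by_cases hqp : q = p
    · subst hqp; exact hqR (dvd_mul_left q D)
    · exact hqR ((hmultD q hq hqm hqp hqΔ).mul_right p)
  have hex : ∀ ι : PadicAlgCl p ≃+* ℂ, ∃ g : CuspForm (Gamma0 M₀) 2, IsNewform0 g ∧
      (∀ ℓ : ℕ, ℓ.Prime → ¬ ℓ ∣ D * p → Valued.v (ι.symm (cuspCoeff f ℓ - cuspCoeff g ℓ)) < 1) ∧
      (∀ ℓ : ℕ, ℓ.Prime → ℓ ∣ D * p → Valued.v (ι.symm (cuspCoeff g ℓ - cuspCoeff f ℓ * (ℓ + 1))) < 1) :=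
    fun ι => hLL W p hp5 hirr hMR hRsq hRcop hp2N rfl hR hK f hf ι
  have hsign : ∀ ℓ : ℕ, ℓ.Prime → ℓ ∣ D → ∃ u : ℤ, u * u = 1 ∧ cuspCoeff f ℓ = u := by
    intro ℓ hℓ hℓD
    haveI : Fact ℓ.Prime := ⟨hℓ⟩
    obtain ⟨-, hmℓ, -⟩ := hDprimes ℓ hℓ hℓD
    refine ⟨W.LFunction ℓ, ?_, hf.2 ℓ⟩
    have hsq := (LFunction_prime_pow_of_hasMultiplicativeReductionAtPrime W ℓ hmℓ 0).2
    rw [pow_two] at hsq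
    exact hsq
  -- the side condition on `D`: its primes are exactly the unramified multiplicative `ℓ ≠ p`
  have hD1D : ∀ ℓ : ℕ, ℓ.Prime → ℓ ∣ D → ℓ % p ≠ 1 := by
    intro ℓ hℓ hℓD
    obtain ⟨hℓp, hmℓ, huℓ⟩ := hDprimes ℓ hℓ hℓD
    exact hD1 ℓ hℓ hℓp hmℓ huℓ
  exact one_le_padicValRat_LOne_div_realPeriod_of_exists_levelLoweredNewform_of_emod_ne_one hGV hI hMz W hp5 hsplit hirr rfl hf
    hMD hpMD hDsq hDM₀ hD1D hsign hex t ht ht0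

/-- ★ **THE EXCEPTIONAL-ZERO TAMAGAWA DIVISIBILITY on X11a, CE-free (CONDITIONAL on five named facts).** At an X11a pair `(W, p)` with
`ρ̄_{E,p}` NOT surjective, `5 ≤ p`, `p` SPLIT multiplicative, and every multiplicative prime `ℓ ≠ p` satisfying `ℓ ≢ 1 (mod p)` (on X11a every
such `ℓ` is unramified for `E[p]`): `L(E,1)/Ω_E = t` for a rational `t ≠ 0` with **`1 ≤ ord_p t`** — `…ExcShallowSector.
one_le_padicValRat_LOne_div_of_classX11a_split` with `hCE` REPLACED by the side condition (finiteness at `p` from non-surjectivity: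
`ClassX11a.dvd_padicValInt_self_of_not_surj`). [cite: DarmonDiamondTaylor1995, Thm. 3.15 and Prop. 2.12] [cite: GreenbergVatsal2000, §3 (17)–(19), Remark 3.4]
[cite: Vatsal1999, §1 (1.6), Thm. (1.13)] [cite: Ribet1984ICM, Thm. 4.1] [cite: Mazur1978, Cor. 4.1] [cite: Serre1972, §2.4 Prop. 15] -/
theorem one_le_padicValRat_LOne_div_of_classX11a_split_of_emod_ne_one
    (hGV : greenbergVatsal2000_plusSymbol_congruence) (hI : ribet1984_iharaLemma)
    (hMz : mazur_not_dvd_maninConstant_of_odd) (hnf : exists_isNewformOf) (hLL : ribet1990_levelLowering_gamma0_newform_general_of_five_le)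
    (hX : ClassX11a W p) (hns : ¬ Surj W p) (hp5 : 5 ≤ p) (hsplit : W.HasSplitMultiplicativeReductionAtPrime p)
    (hD1 : ∀ (ℓ : ℕ) (hℓ : ℓ.Prime), ℓ ≠ p → (haveI : Fact ℓ.Prime := ⟨hℓ⟩; W.HasMultiplicativeReductionAtPrime ℓ) → ℓ % p ≠ 1) :
    ∃ t : ℚ, W.entireLFunction 1 / (W.realPeriodRat : ℂ) = (t : ℂ) ∧ t ≠ 0 ∧ 1 ≤ padicValRat p t := by
  obtain ⟨t, ht, ht0, -⟩ := hX.exists_LOne_div_realPeriod_eq_of_mazur hnf hMz hp5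
  exact ⟨t, ht, ht0, one_le_padicValRat_LOne_div_of_split_of_finite_of_emod_ne_one hGV hI hMz hnf hLL hp5 hsplit hX.irr
    (hX.dvd_padicValInt_self_of_not_surj hns) (fun ℓ hℓ hℓp hmℓ _ ↦ hD1 ℓ hℓ hℓp hmℓ) t ht ht0⟩

/-- ★ **The EXC-SHALLOW sector, CE-free (CONDITIONAL on six named facts): «X11a, `¬ Surj`, `5 ≤ p`, `p` SPLIT multiplicative, every
multiplicative `ℓ ≠ p` has `ℓ ≢ 1 (mod p)`, `ord_p ∏ c_ℓ ≤ 1`, `Ш(E)[p] = 0` ⟹ `MissingUpperBoundAt W p`»** — `…ExcShallowSector.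
missingUpperBoundAt_of_noPTorsion_of_excShallow` with `hCE` REPLACED by the side condition. [cite: Miller2011LMS, Def. 1.1 (arXiv:1010.2431 p. 3)]
[cite: SilvermanATAEC1994, Cor. IV.9.2 (d) and Table 4.1] [cite: DarmonDiamondTaylor1995, Thm. 3.15] [cite: GreenbergVatsal2000, §3 (17)–(19)] -/
theorem missingUpperBoundAt_of_noPTorsion_of_excShallow_of_emod_ne_one
    (hGV : greenbergVatsal2000_plusSymbol_congruence) (hI : ribet1984_iharaLemma)
    (hMz : mazur_not_dvd_maninConstant_of_odd) (hnf : exists_isNewformOf) (hLL : ribet1990_levelLowering_gamma0_newform_general_of_five_le)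
    (hGZK : rank_eq_analyticRank_of_analyticRank_le_one)
    (hX : ClassX11a W p) (hns : ¬ Surj W p) (hp5 : 5 ≤ p) (hsplit : W.HasSplitMultiplicativeReductionAtPrime p)
    (hD1 : ∀ (ℓ : ℕ) (hℓ : ℓ.Prime), ℓ ≠ p → (haveI : Fact ℓ.Prime := ⟨hℓ⟩; W.HasMultiplicativeReductionAtPrime ℓ) → ℓ % p ≠ 1)
    (htam : padicValNat p W.tamagawaProduct ≤ 1) (hSha : ∀ x : W.sha, (p : ℤ) • x = 0 → x = 0) :
    MissingUpperBoundAt W p := by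
  obtain ⟨t, ht, ht0, h1⟩ := one_le_padicValRat_LOne_div_of_classX11a_split_of_emod_ne_one hGV hI hMz hnf hLL hX hns hp5 hsplit hD1
  obtain ⟨q, hq, hv⟩ := exists_shaAn_eq_padicValRat_nonneg_of_one_le hGZK hX.irr ht ht0 h1 htam
  exact hX.missingUpperBoundAt_of_noPTorsion hGZK hq hv hSha

/-- ★ **The EXC-SHALLOW sector, CE-free, class-wide form (CONDITIONAL on six named facts)** — the shape of
`upperNonSurjFive_on_excShallowSector_of_facts` with `hCE` dropped and ONE extra binder on the pair: «every multiplicative `ℓ ≠ p` has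
`ℓ % p ≠ 1`». On that sub-sector G116 (Coleman–Edixhoven 1998 Thm. 2.1) leaves the display. [cite: Miller2011LMS, Def. 1.1 (arXiv:1010.2431 p. 3)]
[cite: DarmonDiamondTaylor1995, Thm. 3.15] [cite: GreenbergVatsal2000, §3 (17)–(19)] -/
theorem upperNonSurjFive_on_excShallowSector_of_emod_ne_one
    (hGV : greenbergVatsal2000_plusSymbol_congruence) (hI : ribet1984_iharaLemma)
    (hMz : mazur_not_dvd_maninConstant_of_odd) (hnf : exists_isNewformOf) (hLL : ribet1990_levelLowering_gamma0_newform_general_of_five_le)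
    (hGZK : rank_eq_analyticRank_of_analyticRank_le_one) :
    ∀ (W : WeierstrassCurve ℚ) [W.IsElliptic] [W.IsGloballyMinimal] (p : ℕ) [Fact p.Prime],
      ClassX11a W p → ¬ Surj W p → 5 ≤ p → W.HasSplitMultiplicativeReductionAtPrime p →
      (∀ (ℓ : ℕ) (hℓ : ℓ.Prime), ℓ ≠ p → (haveI : Fact ℓ.Prime := ⟨hℓ⟩; W.HasMultiplicativeReductionAtPrime ℓ) → ℓ % p ≠ 1) →
      padicValNat p W.tamagawaProduct ≤ 1 → (∀ x : W.sha, (p : ℤ) • x = 0 → x = 0) → MissingUpperBoundAt W p :=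
  fun _ _ _ _ _ hX hns hp5 hsplit hD1 htam hSha =>
    missingUpperBoundAt_of_noPTorsion_of_excShallow_of_emod_ne_one hGV hI hMz hnf hLL hGZK hX hns hp5 hsplit hD1 htam hSha

end Curve

end Summit.BirchSwinnertonDyer.BirchSwinnertonDyer.Theorems.GL1Cartan.Exc

end
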